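import Mathlib
import Summits.ValiantsHypothesis.ValiantsHypothesis.Theorems.NewtonUnitEquationsNewtonTauWeakAutomatonRadixDefs
import Summits.ValiantsHypothesis.ValiantsHypothesis.Theorems.NewtonUnitEquationsNewtonTauWeakAutomatonGenCoeff

/-!
# `NewtonUnitEquationsNewtonTauWeakAutomatonRadixCoeff` — mixed-radix carry automaton: correctness of the transfer matrices

Rung toward `stub_binomialNewtonTauCommon` (crux `NewtonTauWeak`, stmt-ValiantsHypothesis-5904), line
`binomial-normal-form`, MIXED-RADIX CARRY AUTOMATON (Theorem C): registered stub `stub_radCoeff`, the radix-`(bx, by)`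
generalisation of `stub_genCoeff` (Theorem B, radix `(2, 2)`, `…AutomatonGenCoeff.lean`).

Claim.  For a radix pair `bx, by ≥ 2`, level polynomials `G i` of degree `≤ C` in each variable, digits
`P ∈ [0, bx^n) × [0, by^n)` and a final carry `t ∈ {0..C}²`, the coefficient of
`radProd bx by G n = Π_{i<n} G_i(x^{bx^i}, y^{by^i})` at the position `(bx^n t₁ + P₁, by^n t₂ + P₂)` is the `((0,0), t)`
entry of the ordered product `radN bx by C G 0 n P` of the carry transfer matrices `radT bx by C (G i) p_i q_i`
(`p_i = digit bx i P₁`, `q_i = digit by i P₂` the mixed-radix digits of `P`).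

Proof.  Induction on `n`, for ALL final carries `k ∈ ℕ²` at once (the entry being read as `0` when `k ∉ {0..C}²`:
`coeff_radProd_aux`), peeling the top level: `radProd … (n+1) = radProd … n · G_n(x^{bx^n}, y^{by^n})`
(`Finset.prod_range_succ`) and `radN … (n+1) = radN … n · radT …` (`List.range'_concat`).  The radix substitution
sends a monomial `x^{u₀} y^{u₁}` to `x^{a u₀} y^{b u₁}` (`radExpand_monomial`, via `MvPolynomial.aeval_monomial`), so the
top factor is the sum of the monomials `G_n[u] x^{bx^n u₀} y^{by^n u₁}` (`radExpand_eq_sum`); the coefficient of a product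
with a monomial is a shifted coefficient (`AutoCoeffAux.coeff_mul_pairMonomial`); with `P' = bx^n D + R` (`D < bx` the
top digit, `R < bx^n`) the shift `bx^{n+1} k + P' - bx^n u = bx^n (bx k + D - u) + R` is again of the shape of the
induction hypothesis, with new final carry `κ = bx k + D - u`, i.e. `u = bx κ' + D - κ` read backwards — exactly the
transition rule of `radT`; carries `> C` contribute `0` because `deg G_n ≤ C` and `bx, by ≥ 2` (`bx k + D = u + κ ≤ 2C`
forces `k ≤ C`).  The low product only reads the digits below `n` (`radN_low`, `digit_low`).
[folklore: carry automaton / transfer matrices of mixed-radix digit expansions]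
-/

set_option linter.dupNamespace false

noncomputable section

open scoped BigOperators
open MvPolynomial

namespace Summit.ValiantsHypothesis.ValiantsHypothesis.Theorems.NewtonTauWeakAutomaton

namespace RadCoeffAux

open AutoCoeffAux

/-! ## Peeling the top level -/

/-- `radProd` with one more level: the top factor splits off. -/
theorem radProd_succ (bx by' : ℕ) (G : ℕ → MvPolynomial (Fin 2) ℂ) (n : ℕ) :
    radProd bx by' G (n + 1) = radProd bx by' G n * radExpand (bx ^ n) (by' ^ n) (G n) := by
  unfold radProd
  rw [Finset.prod_range_succ]

/-- `radN` over the levels `[0, n+1)`: the top transfer matrix splits off on the right. -/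
theorem radN_succ (bx by' C : ℕ) (G : ℕ → MvPolynomial (Fin 2) ℂ) (n p q : ℕ) :
    radN bx by' C G 0 (n + 1) (p, q) =
      radN bx by' C G 0 n (p, q) * radT bx by' C (G n) (digit bx n p) (digit by' n q) := by
  unfold radN
  rw [List.range'_concat, List.map_append, List.prod_append, List.map_singleton, List.prod_singleton]
  simp

/-! ## Digit arithmetic in base `b` -/

/-- The digits below level `n` do not see the levels `≥ n`: `digit b i (b^n D + R) = digit b i R` for `i < n`. -/
theorem digit_low (b i n D R : ℕ) (hb : 0 < b) (hi : i < n) : digit b i (b ^ n * D + R) = digit b i R := by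
  obtain ⟨m, rfl⟩ : ∃ m, n = i + 1 + m := ⟨n - (i + 1), by omega⟩
  unfold digit
  have e : b ^ (i + 1 + m) * D + R = b ^ i * (b * (b ^ m * D)) + R := by ring
  rw [e, Nat.mul_add_div (pow_pos hb i), Nat.mul_add_mod]

/-- The top digit of `b^n D + R` (`D < b`, `R < b^n`) is `D`. -/
theorem digit_top (b n D R : ℕ) (hD : D < b) (hR : R < b ^ n) : digit b n (b ^ n * D + R) = D := by
  unfold digit
  rw [Nat.mul_add_div (Nat.zero_lt_of_lt hR), Nat.div_eq_of_lt hR, add_zero, Nat.mod_eq_of_lt hD]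

/-- `radN … 0 n` only reads the digits below `n`: the top digits `D0, D1` can be dropped. -/
theorem radN_low (bx by' C : ℕ) (G : ℕ → MvPolynomial (Fin 2) ℂ) (hbx : 0 < bx) (hby : 0 < by')
    (n D0 R0 D1 R1 : ℕ) :
    radN bx by' C G 0 n (bx ^ n * D0 + R0, by' ^ n * D1 + R1) = radN bx by' C G 0 n (R0, R1) := by
  unfold radN
  congr 1
  apply List.map_congr_left
  intro i hi
  rw [List.mem_range'_1] at hi
  have hi' : i < n := by omega
  dsimp only
  rw [digit_low bx i n D0 R0 hbx hi', digit_low by' i n D1 R1 hby hi']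

/-- Splitting off the top digit: a number `< b^{n+1}` is `b^n D + R` with `D < b`, `R < b^n`. -/
theorem exists_digit (b p n : ℕ) (hb : 0 < b) (hp : p < b ^ (n + 1)) :
    ∃ D R : ℕ, D < b ∧ R < b ^ n ∧ p = b ^ n * D + R := by
  refine ⟨p / b ^ n, p % b ^ n, ?_, Nat.mod_lt _ (pow_pos hb n), (Nat.div_add_mod p (b ^ n)).symm⟩
  rw [Nat.div_lt_iff_lt_mul (pow_pos hb n)]
  calc p < b ^ (n + 1) := hp
    _ = b * b ^ n := by ring

/-- Digit bookkeeping: `b^n u ≤ b^{n+1} k + b^n D + R` iff `u ≤ b k + D` (for `R < b^n`). -/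
theorem le_pos_iff (b n k D R u : ℕ) (hR : R < b ^ n) :
    b ^ n * u ≤ b ^ (n + 1) * k + (b ^ n * D + R) ↔ u ≤ b * k + D := by
  have h2n : 0 < b ^ n := Nat.zero_lt_of_lt hR
  have e : b ^ (n + 1) * k + (b ^ n * D + R) = b ^ n * (b * k + D) + R := by ring
  rw [e, mul_comm (b ^ n) u, ← Nat.le_div_iff_mul_le h2n, Nat.mul_add_div h2n, Nat.div_eq_of_lt hR, add_zero]

/-- Digit bookkeeping: removing the level-`n` contribution `b^n u` leaves `b^n (b k + D - u) + R`. -/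
theorem pos_sub (b n k D R u : ℕ) (hu : u ≤ b * k + D) :
    b ^ (n + 1) * k + (b ^ n * D + R) - b ^ n * u = b ^ n * (b * k + D - u) + R := by
  have e : b ^ (n + 1) * k + (b ^ n * D + R) = b ^ n * (b * k + D) + R := by ring
  have e2 : b ^ n * (b * k + D - u) + b ^ n * u = b ^ n * (b * k + D) := by
    rw [← mul_add, Nat.sub_add_cancel hu]
  rw [e]
  omega

/-! ## The radix substitution on monomials -/

/-- The radix substitution on a monomial: `c x^{u₀} y^{u₁} ↦ c x^{a u₀} y^{b u₁}`. -/
theorem radExpand_monomial (a b : ℕ) (u : Fin 2 →₀ ℕ) (c : ℂ) :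
    radExpand a b (monomial u c) = monomial (Finsupp.single 0 (a * u 0) + Finsupp.single 1 (b * u 1)) c := by
  unfold radExpand
  rw [aeval_monomial, Finsupp.prod_fintype _ _ (fun i => pow_zero _), Fin.prod_univ_two]
  have e : ((X (0 : Fin 2) : MvPolynomial (Fin 2) ℂ) ^ (if (0 : Fin 2) = 0 then a else b)) ^ (u 0) *
      ((X (1 : Fin 2) : MvPolynomial (Fin 2) ℂ) ^ (if (1 : Fin 2) = 0 then a else b)) ^ (u 1) =
      monomial (Finsupp.single 0 (a * u 0) + Finsupp.single 1 (b * u 1)) 1 := by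
    rw [if_pos rfl, if_neg (by decide), ← pow_mul, ← pow_mul, X_pow_eq_monomial, X_pow_eq_monomial,
      monomial_mul, one_mul]
  rw [e, algebraMap_eq, C_mul_monomial, mul_one]

/-- The top factor expanded: `F(x^a, y^b) = Σ_{u ∈ supp F} F[u] · x^{a u₀} y^{b u₁}`. -/
theorem radExpand_eq_sum (a b : ℕ) (F : MvPolynomial (Fin 2) ℂ) :
    radExpand a b F =
      ∑ u ∈ F.support, monomial (Finsupp.single 0 (a * u 0) + Finsupp.single 1 (b * u 1)) (coeff u F) := by
  conv_lhs => rw [F.as_sum]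
  rw [map_sum]
  exact Finset.sum_congr rfl fun u _ => radExpand_monomial a b u (coeff u F)

/-! ## The induction -/

/-- Base of the induction (`n = 0`): both sides are `[k = (0,0)]`. -/
theorem base (bx by' C : ℕ) (G : ℕ → MvPolynomial (Fin 2) ℂ) (k0 k1 p q : ℕ) (hp : p < bx ^ 0)
    (hq : q < by' ^ 0) :
    coeff (Finsupp.single 0 (bx ^ 0 * k0 + p) + Finsupp.single 1 (by' ^ 0 * k1 + q)) (radProd bx by' G 0) =
      ∑ κ : GSt C, if (κ.1 : ℕ) = k0 ∧ (κ.2 : ℕ) = k1 then radN bx by' C G 0 0 (p, q) (0, 0) κ else 0 := by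
  have hp0 : p = 0 := by simpa using hp
  have hq0 : q = 0 := by simpa using hq
  subst hp0
  subst hq0
  have e1 : radProd bx by' G 0 = 1 := by simp [radProd]
  have e2 : radN bx by' C G 0 0 (0, 0) = 1 := by simp [radN]
  rw [e1, e2, coeff_one]
  simp only [pow_zero, one_mul, add_zero]
  rw [Finset.sum_eq_single ((0 : Fin (C + 1)), (0 : Fin (C + 1)))]
  · have e3 : ((0 : Fin 2 →₀ ℕ) = Finsupp.single 0 k0 + Finsupp.single 1 k1) ↔ k0 = 0 ∧ k1 = 0 := by
      rw [pair_eq_iff]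
      simp [eq_comm]
    simp only [e3, Matrix.one_apply_eq, Fin.val_zero]
    split_ifs <;> first | (exfalso; omega) | rfl
  · intro κ _ hne
    rw [Matrix.one_apply_ne' hne]
    simp
  · intro h
    exact absurd (Finset.mem_univ _) h

/-- One term of the induction step (fixed level-`n` contribution `u` with weight `a`): the shifted coefficient, evaluated
by the induction hypothesis, is the `u`-part of `(radN · radT)((0,0), k)`. -/
theorem step_term (bx by' C : ℕ) (G : ℕ → MvPolynomial (Fin 2) ℂ) (n : ℕ)
    (ih : ∀ (k0 k1 p q : ℕ), p < bx ^ n → q < by' ^ n →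
      coeff (Finsupp.single 0 (bx ^ n * k0 + p) + Finsupp.single 1 (by' ^ n * k1 + q)) (radProd bx by' G n) =
        ∑ κ : GSt C, if (κ.1 : ℕ) = k0 ∧ (κ.2 : ℕ) = k1 then radN bx by' C G 0 n (p, q) (0, 0) κ else 0)
    (k0 k1 D0 R0 D1 R1 : ℕ) (hR0 : R0 < bx ^ n) (hR1 : R1 < by' ^ n) (u : Fin 2 →₀ ℕ) (a : ℂ) :
    (if bx ^ n * u 0 ≤ bx ^ (n + 1) * k0 + (bx ^ n * D0 + R0) ∧
        by' ^ n * u 1 ≤ by' ^ (n + 1) * k1 + (by' ^ n * D1 + R1) then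
        coeff (Finsupp.single 0 (bx ^ (n + 1) * k0 + (bx ^ n * D0 + R0) - bx ^ n * u 0) +
            Finsupp.single 1 (by' ^ (n + 1) * k1 + (by' ^ n * D1 + R1) - by' ^ n * u 1)) (radProd bx by' G n) * a
      else 0) =
    ∑ κ : GSt C, radN bx by' C G 0 n (R0, R1) (0, 0) κ *
      (if (κ.1 : ℕ) ≤ bx * k0 + D0 ∧ (κ.2 : ℕ) ≤ by' * k1 + D1 ∧
          u = Finsupp.single 0 (bx * k0 + D0 - κ.1) + Finsupp.single 1 (by' * k1 + D1 - κ.2) then a else 0) := by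
  simp only [le_pos_iff bx n k0 D0 R0 (u 0) hR0, le_pos_iff by' n k1 D1 R1 (u 1) hR1]
  by_cases hA : u 0 ≤ bx * k0 + D0 ∧ u 1 ≤ by' * k1 + D1
  · rw [if_pos hA, pos_sub bx n k0 D0 R0 (u 0) hA.1, pos_sub by' n k1 D1 R1 (u 1) hA.2,
      ih (bx * k0 + D0 - u 0) (by' * k1 + D1 - u 1) R0 R1 hR0 hR1, Finset.sum_mul]
    refine Finset.sum_congr rfl fun κ _ => ?_
    simp only [pair_eq_iff]
    obtain ⟨hA1, hA2⟩ := hA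
    split_ifs with h h' h' <;> first | (exfalso; omega) | ring
  · rw [if_neg hA]
    symm
    refine Finset.sum_eq_zero fun κ _ => ?_
    simp only [pair_eq_iff]
    rw [if_neg, mul_zero]
    rintro ⟨-, -, h3, h4⟩
    exact hA ⟨by omega, by omega⟩

/-- The induction step, assembled: summing the `u`-parts over the monomials `u` of the top factor gives
`[k ∈ {0..C}²] · (radN over n+1 levels)((0,0), k)` (reindex `u ↔ κ`, `Matrix.mul_apply`; carries `> C` contribute `0`
since `deg G_n ≤ C` and `bx, by ≥ 2`). -/
theorem assemble (bx by' C : ℕ) (hbx : 2 ≤ bx) (hby : 2 ≤ by') (G : ℕ → MvPolynomial (Fin 2) ℂ)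
    (hG : ∀ i, ∀ e ∈ (G i).support, e 0 ≤ C ∧ e 1 ≤ C)
    (n k0 k1 D0 R0 D1 R1 : ℕ) (hD0 : D0 < bx) (hD1 : D1 < by') (hR0 : R0 < bx ^ n) (hR1 : R1 < by' ^ n) :
    (∑ u ∈ (G n).support, ∑ κ : GSt C, radN bx by' C G 0 n (R0, R1) (0, 0) κ *
      (if (κ.1 : ℕ) ≤ bx * k0 + D0 ∧ (κ.2 : ℕ) ≤ by' * k1 + D1 ∧
          u = Finsupp.single 0 (bx * k0 + D0 - κ.1) + Finsupp.single 1 (by' * k1 + D1 - κ.2) then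
        coeff u (G n) else 0)) =
    ∑ τ : GSt C, if (τ.1 : ℕ) = k0 ∧ (τ.2 : ℕ) = k1 then
      radN bx by' C G 0 (n + 1) (bx ^ n * D0 + R0, by' ^ n * D1 + R1) (0, 0) τ else 0 := by
  rw [Finset.sum_comm]
  have inner : ∀ κ : GSt C, (∑ u ∈ (G n).support, radN bx by' C G 0 n (R0, R1) (0, 0) κ *
      (if (κ.1 : ℕ) ≤ bx * k0 + D0 ∧ (κ.2 : ℕ) ≤ by' * k1 + D1 ∧
          u = Finsupp.single 0 (bx * k0 + D0 - κ.1) + Finsupp.single 1 (by' * k1 + D1 - κ.2) then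
        coeff u (G n) else 0)) =
      radN bx by' C G 0 n (R0, R1) (0, 0) κ *
        (if (κ.1 : ℕ) ≤ bx * k0 + D0 ∧ (κ.2 : ℕ) ≤ by' * k1 + D1 then
          coeff (Finsupp.single 0 (bx * k0 + D0 - κ.1) + Finsupp.single 1 (by' * k1 + D1 - κ.2)) (G n)
        else 0) := by
    intro κ
    rw [← Finset.mul_sum]
    congr 1
    by_cases hle : (κ.1 : ℕ) ≤ bx * k0 + D0 ∧ (κ.2 : ℕ) ≤ by' * k1 + D1
    · rw [if_pos hle]
      have hs : ∀ u ∈ (G n).support,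
          (if (κ.1 : ℕ) ≤ bx * k0 + D0 ∧ (κ.2 : ℕ) ≤ by' * k1 + D1 ∧
              u = Finsupp.single 0 (bx * k0 + D0 - κ.1) + Finsupp.single 1 (by' * k1 + D1 - κ.2) then
            coeff u (G n) else 0) =
          (if u = Finsupp.single 0 (bx * k0 + D0 - κ.1) + Finsupp.single 1 (by' * k1 + D1 - κ.2) then
            coeff u (G n) else 0) := by
        intro u _
        simp only [hle, true_and]
      rw [Finset.sum_congr rfl hs, Finset.sum_ite_eq']
      split_ifs with hmem
      · rfl
      · exact (notMem_support_iff.mp hmem).symm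
    · rw [if_neg hle]
      refine Finset.sum_eq_zero fun u _ => ?_
      rw [if_neg]
      intro h
      exact hle ⟨h.1, h.2.1⟩
  have hbx0 : 0 < bx := by omega
  have hby0 : 0 < by' := by omega
  rw [Finset.sum_congr rfl fun κ _ => inner κ, radN_succ, digit_top bx n D0 R0 hD0 hR0,
    digit_top by' n D1 R1 hD1 hR1, radN_low bx by' C G hbx0 hby0 n D0 R0 D1 R1]
  by_cases hk : k0 ≤ C ∧ k1 ≤ C
  · symm
    rw [Finset.sum_eq_single
      ((⟨k0, Nat.lt_succ_of_le hk.1⟩ : Fin (C + 1)), (⟨k1, Nat.lt_succ_of_le hk.2⟩ : Fin (C + 1)))]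
    · rw [if_pos ⟨rfl, rfl⟩, Matrix.mul_apply]
      refine Finset.sum_congr rfl fun κ _ => ?_
      simp only [radT]
    · intro τ _ hne
      rw [if_neg]
      intro h
      exact hne (Prod.ext (Fin.ext h.1) (Fin.ext h.2))
    · intro h
      exact absurd (Finset.mem_univ _) h
  · have h2k0 : 2 * k0 ≤ bx * k0 := Nat.mul_le_mul_right k0 hbx
    have h2k1 : 2 * k1 ≤ by' * k1 := Nat.mul_le_mul_right k1 hby
    have rhs0 : ∀ τ : GSt C, ¬ ((τ.1 : ℕ) = k0 ∧ (τ.2 : ℕ) = k1) := by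
      intro τ h
      have := τ.1.isLt
      have := τ.2.isLt
      omega
    simp only [rhs0, if_false, Finset.sum_const_zero]
    refine Finset.sum_eq_zero fun κ _ => ?_
    split_ifs with hle
    · rw [notMem_support_iff.mp, mul_zero]
      intro hmem
      have hb := hG n _ hmem
      rw [pair_apply_zero, pair_apply_one] at hb
      have := κ.1.isLt
      have := κ.2.isLt
      omega
    · exact mul_zero _

/-- **The induction** (automaton correctness for all final carries `k ∈ ℕ²` at once): the coefficient of
`radProd bx by G n` at `(bx^n k₀ + p, by^n k₁ + q)` (`p < bx^n`, `q < by^n`) is the `((0,0), k)` entry of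
`radN bx by C G 0 n (p, q)` if `k ∈ {0..C}²`, else `0`. -/
theorem coeff_radProd_aux (bx by' C : ℕ) (hbx : 2 ≤ bx) (hby : 2 ≤ by') (G : ℕ → MvPolynomial (Fin 2) ℂ)
    (hG : ∀ i, ∀ e ∈ (G i).support, e 0 ≤ C ∧ e 1 ≤ C) (n : ℕ) :
    ∀ (k0 k1 p q : ℕ), p < bx ^ n → q < by' ^ n →
      coeff (Finsupp.single 0 (bx ^ n * k0 + p) + Finsupp.single 1 (by' ^ n * k1 + q)) (radProd bx by' G n) =
        ∑ κ : GSt C, if (κ.1 : ℕ) = k0 ∧ (κ.2 : ℕ) = k1 then radN bx by' C G 0 n (p, q) (0, 0) κ else 0 := by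
  induction n with
  | zero =>
    intro k0 k1 p q hp hq
    exact base bx by' C G k0 k1 p q hp hq
  | succ n ih =>
    intro k0 k1 p q hp hq
    obtain ⟨D0, R0, hD0, hR0, rfl⟩ := exists_digit bx p n (by omega) hp
    obtain ⟨D1, R1, hD1, hR1, rfl⟩ := exists_digit by' q n (by omega) hq
    rw [radProd_succ, radExpand_eq_sum, Finset.mul_sum, coeff_sum]
    have step1 : ∀ u : Fin 2 →₀ ℕ,
        coeff (Finsupp.single 0 (bx ^ (n + 1) * k0 + (bx ^ n * D0 + R0)) +
            Finsupp.single 1 (by' ^ (n + 1) * k1 + (by' ^ n * D1 + R1)))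
          (radProd bx by' G n *
            monomial (Finsupp.single 0 (bx ^ n * u 0) + Finsupp.single 1 (by' ^ n * u 1)) (coeff u (G n))) =
        ∑ κ : GSt C, radN bx by' C G 0 n (R0, R1) (0, 0) κ *
          (if (κ.1 : ℕ) ≤ bx * k0 + D0 ∧ (κ.2 : ℕ) ≤ by' * k1 + D1 ∧
              u = Finsupp.single 0 (bx * k0 + D0 - κ.1) + Finsupp.single 1 (by' * k1 + D1 - κ.2) then
            coeff u (G n) else 0) := by
      intro u
      rw [coeff_mul_pairMonomial]
      exact step_term bx by' C G n ih k0 k1 D0 R0 D1 R1 hR0 hR1 u (coeff u (G n))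
    rw [Finset.sum_congr rfl fun u _ => step1 u]
    exact assemble bx by' C hbx hby G hG n k0 k1 D0 R0 D1 R1 hD0 hD1 hR0 hR1

end RadCoeffAux

open RadCoeffAux

/-- **Mixed-radix carry automaton: correctness.**  For a radix pair `bx, by ≥ 2`, level polynomials `G i` of degree
`≤ C` in each variable (`hG`), digits `P ∈ [0, bx^n) × [0, by^n)` and a final carry `t ∈ {0..C}²`, the coefficient of
`radProd bx by G n = Π_{i<n} G_i(x^{bx^i}, y^{by^i})` at the position `(bx^n t₁ + P₁, by^n t₂ + P₂)` is the `((0,0), t)`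
entry of the ordered product `radN bx by C G 0 n P` of the carry transfer matrices `radT bx by C (G i) p_i q_i`
(`p_i, q_i` the base-`bx` / base-`by` digits of `P`).  Induction on `n` peeling the top level
(`RadCoeffAux.coeff_radProd_aux`); the binary case is `stub_genCoeff`. [folklore: carry automaton in mixed radix] -/
theorem stub_radCoeff (bx by' C : ℕ) (hbx : 2 ≤ bx) (hby : 2 ≤ by') (G : ℕ → MvPolynomial (Fin 2) ℂ)
    (hG : ∀ i, ∀ e ∈ (G i).support, e 0 ≤ C ∧ e 1 ≤ C) (n : ℕ) (t : Fin (C + 1) × Fin (C + 1)) (P : ℕ × ℕ)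
    (hP : P.1 < bx ^ n ∧ P.2 < by' ^ n) :
    coeff (Finsupp.single 0 (bx ^ n * (t.1 : ℕ) + P.1) + Finsupp.single 1 (by' ^ n * (t.2 : ℕ) + P.2))
        (radProd bx by' G n) =
      radN bx by' C G 0 n P ((0 : Fin (C + 1)), (0 : Fin (C + 1))) t := by
  rw [coeff_radProd_aux bx by' C hbx hby G hG n t.1 t.2 P.1 P.2 hP.1 hP.2, Finset.sum_eq_single t]
  · rw [if_pos ⟨rfl, rfl⟩]
  · intro κ _ hne
    rw [if_neg]
    intro h
    exact hne (Prod.ext (Fin.ext h.1) (Fin.ext h.2))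
  · intro h
    exact absurd (Finset.mem_univ _) h

end Summit.ValiantsHypothesis.ValiantsHypothesis.Theorems.NewtonTauWeakAutomaton

end
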